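import Summits.QuantumFields.YangMills.Theorems.BalabanUVNodesN19TargetEverySource
import Mathlib.Analysis.Analytic.OfScalars
import Mathlib.Analysis.SpecialFunctions.Complex.Analytic

/-!
# BalabanUVNodes ∕ N19 (NE7 proper) — THE CONTINUUM GENERATING FUNCTION IS REAL-ANALYTIC ON ALL OF ℝ under N19's DECL target on any
# window: the complex generating functions `z ↦ ⟨e^{z∏os}⟩_K` converge on ℂ to an ENTIRE function `Φ`, and `genFunLim = log Re Φ|_ℝ`

Cell `pub-ymgap` (HUMAN RULING D-0062, Track A), R141 (C) WIDER STRATEGY seat `pub-ymgap-dag-n19-e` (strategy s3 «alternative currency»), gen 8,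
fourth module; filed `--kind proof --supports` K3‴ `SpineGivenEndpointR13` = stmt-QuantumFields-19912 `--as helper` (route rev 17).  COUNT-NEUTRAL.
THEOREMS ONLY (0 `def`); imports this seat's `…N19TargetEverySource` (p501027 — the Vitali-at-every-source module: `tendsto_mgf_all_of_tendsto_cgf`,
`tendsto_cgf_gibbs_of_target`; through it tree node E3 `T4VitaliStep` and `Literature.Analysis.Complex.BoundedAnalyticFamilyLimit`), Mathlib's
`Analysis.Analytic.OfScalars` (scalar power series) and `Analysis.SpecialFunctions.Complex.Analytic` (`analyticAt_log`, `AnalyticAt.re_ofReal`); edits nothing.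

WHAT THIS IS.  The sibling showed that under `Spine.NE7.Target vol l₀ δ (schemeZ S os)` the generating functions `G_K = genFun (schemeZ S os) K`
converge at EVERY real source.  Here the limit is identified as a REAL-ANALYTIC function: the tree's Vitali step (node E3) hands, on every disc, the
limit of the entire family `z ↦ ⟨e^{z·∏os}⟩_K` (bounded by `e^{‖z‖}`) as the power series of the limits `aₙ` of the Taylor coefficients at `0`
(`exists_taylorLimit_complexMGF`: Cauchy bounds `‖aₙ‖ ≤ e^{R|B|}∕Rⁿ` for EVERY `R`, radii glued by uniqueness of limits); such a series is ENTIRE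
(`analyticAt_tsum_of_coeff_bound`: Mathlib `FormalMultilinearSeries.ofScalars` with infinite radius); its restriction to ℝ is the limit of the real
MGF's, hence `≥ e^{−|t|B} > 0`, and its logarithm is the limit of the cgf's (`exists_entire_limit_complexMGF`), which is therefore REAL-ANALYTIC
on all of ℝ (`exists_analytic_limit_cgf`: Mathlib `analyticAt_log` ∘ `AnalyticAt.re_ofReal`).  At the torus scheme (§2): ★ `exists_entire_limit_of_target`,
★★ `analyticAt_genFunLim_of_target` — `AnalyticAt ℝ (T4CauchySum.genFunLim (schemeZ S os)) t` for EVERY `t ∈ ℝ` (and `G_K(t) → genFunLim t` there),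
`contDiffAt_genFunLim_of_target`.  With the siblings: under N19's DECL target on any window the continuum generating function of a string exists
on all of ℝ, is real-analytic, its derivative is the continuum sourced expectation (p499283, inside the window with the lin-log tail rate), and every
sourced moment converges at every source (sibling).

HONEST FRAMING.  [folklore] complex analysis BY NAME (tree node E3 ∕ `BoundedAnalyticFamilyLimit`; Mathlib power series and `log` analyticity) +
bookkeeping; qualitative (no rate outside the window, no identification of `Φ` beyond being the limit); `Target` is a HYPOTHESIS (NE7 NOT PRINTED as a
two-run statement for d = 4, NOT proved); nothing of Bałaban's is instantiated; N19 NOT discharged (0∕1); K3‴ NOT claimed; counts UNMOVED (5∕27).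
One finite four-torus programme at fixed `ε` (the `K → ∞` limit of the cut-off sequence on ONE torus) — NOT ℝ⁴, NOT infinite volume, NOT OS, NOT a mass
gap, NOT Clay.  0 `def`; 0 `sorry`; standard axioms; no decl below carries a cite tag.
-/

noncomputable section

open Set Metric Filter Topology MeasureTheory ProbabilityTheory
open scoped Nat ENNReal NNReal

namespace Summit.QuantumFields.YangMills.BalabanUVNodes.N19ContinuumGenFunAnalytic

open Literature.MathematicalPhysics.QuantumFieldTheory.Balaban1983to89
open T4VitaliStep (tendsto_of_tendsto_at exists_seq_tendsto_zero_of_forall_Ioo)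
open Summit.QuantumFields.YangMills.BalabanUVNodes.N19TargetEverySource (tendsto_mgf_all_of_tendsto_cgf)

/-! ## §1 Generic [folklore]: the complex MGF's of a bounded family whose cgf's converge on `(0, r)` converge at every `z ∈ ℂ` to an ENTIRE function
`Φ(z) = Σ zⁿ aₙ` (`‖aₙ‖ ≤ e^{R|B|}∕Rⁿ` for every `R > 0`); its restriction to ℝ is positive and real-analytic, and so is `log Φ|_ℝ = lim cgf` -/

section Generic

variable {Ω : ℕ → Type*} [∀ K, MeasurableSpace (Ω K)] {μ : ∀ K, Measure (Ω K)} [∀ K, IsProbabilityMeasure (μ K)]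
  {X : ∀ K, Ω K → ℝ} {B r : ℝ}

/-- **THE TAYLOR COEFFICIENTS AT THE ORIGIN CONVERGE, WITH CAUCHY BOUNDS AT EVERY RADIUS, AND THE COMPLEX MGF's CONVERGE EVERYWHERE TO THE POWER
SERIES THEY DEFINE** [folklore].  Probability measures `μ K`, `|X K| ≤ B`; cgf's convergent on `(0, r)`.  Then there is `a : ℕ → ℂ` with
`(n!)⁻¹·(complexMGF (X K) (μ K))⁽ⁿ⁾(0) → aₙ`, `‖aₙ‖ ≤ e^{R|B|}∕Rⁿ` for EVERY `R > 0`, and `complexMGF (X K) (μ K) z → Σₙ zⁿ·aₙ` for EVERY `z ∈ ℂ`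
(tree node E3 `tendsto_of_tendsto_at` on every disc; uniqueness of limits glues the radii). -/
theorem exists_taylorLimit_complexMGF (hX : ∀ K, AEMeasurable (X K) (μ K)) (hB : ∀ K ω, |X K ω| ≤ B) (hr : 0 < r)
    (hconv : ∀ t : ℝ, 0 < t → t < r → ∃ y, Tendsto (fun K => cgf (X K) (μ K) t) atTop (𝓝 y)) :
    ∃ a : ℕ → ℂ, (∀ n, Tendsto (fun K => (n ! : ℂ)⁻¹ • iteratedDeriv n (complexMGF (X K) (μ K)) 0) atTop (𝓝 (a n))) ∧
      (∀ R : ℝ, 0 < R → ∀ n, ‖a n‖ ≤ Real.exp (R * |B|) / R ^ n) ∧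
      ∀ z : ℂ, Tendsto (fun K => complexMGF (X K) (μ K) z) atTop (𝓝 (∑' n, z ^ n • a n)) := by
  -- the E3 package on the disc of radius `R`
  have hd : ∀ (R : ℝ) (K : ℕ), DiffContOnCl ℂ (complexMGF (X K) (μ K)) (ball 0 R) := fun R K =>
    (T4VitaliStep.differentiable_complexMGF (hX K) (hB K)).diffContOnCl
  have hMK : ∀ R : ℝ, ∀ K, ∀ w ∈ sphere (0 : ℂ) R, ‖complexMGF (X K) (μ K) w‖ ≤ Real.exp (R * |B|) := fun R K w hw => by
    rw [mem_sphere_zero_iff_norm] at hw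
    calc ‖complexMGF (X K) (μ K) w‖ ≤ Real.exp (‖w‖ * |B|) := T4VitaliStep.norm_complexMGF_le (hX K) (hB K) w
      _ = Real.exp (R * |B|) := by rw [hw]
  obtain ⟨t, ht0, htne, ht⟩ := exists_seq_tendsto_zero_of_forall_Ioo hr hconv
  have hx0 : Tendsto (fun m => (t m : ℂ)) atTop (𝓝 0) := by
    have h := (Complex.continuous_ofReal.tendsto 0).comp ht0
    rw [Complex.ofReal_zero] at h
    exact h
  have hF : ∀ m, ∃ y, Tendsto (fun K => complexMGF (X K) (μ K) (t m)) atTop (𝓝 y) := fun m => by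
    obtain ⟨y, hy⟩ := ht m
    refine ⟨((Real.exp y : ℝ) : ℂ), ((Complex.continuous_ofReal.tendsto _).comp ((Real.continuous_exp.tendsto y).comp hy)).congr
      fun K => ?_⟩
    simp only [Function.comp_apply, complexMGF_ofReal]
    rw [exp_cgf (T4VitaliStep.integrable_exp_mul_of_bounded (hX K) (hB K) _)]
  have pkg : ∀ R : ℝ, 0 < R → ∃ a : ℕ → ℂ,
      (∀ n, Tendsto (fun K => (n ! : ℂ)⁻¹ • iteratedDeriv n (complexMGF (X K) (μ K)) 0) atTop (𝓝 (a n))) ∧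
      ∀ z : ℂ, ‖z‖ < R → Tendsto (fun K => complexMGF (X K) (μ K) z) atTop (𝓝 (∑' n, z ^ n • a n)) := fun R hR =>
    tendsto_of_tendsto_at hR (hd R) (hMK R) hx0 (fun m => Complex.ofReal_ne_zero.2 (htne m)) hF
  obtain ⟨a, ha, -⟩ := pkg 1 one_pos
  refine ⟨a, ha, fun R hR n => ?_, fun z => ?_⟩
  · -- Cauchy's estimate for every `K`, passed to the limit
    refine le_of_tendsto' ((continuous_norm.tendsto _).comp (ha n)) fun K => ?_
    exact Literature.Analysis.Complex.norm_inv_factorial_smul_iteratedDeriv_le hR (hd R K) (hMK R K) n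
  · obtain ⟨a', ha', hlim⟩ := pkg (‖z‖ + 1) (by positivity)
    have heq : a' = a := funext fun n => tendsto_nhds_unique (ha' n) (ha n)
    rw [← heq]
    exact hlim z (by linarith)

/-- **THE LIMIT POWER SERIES IS ENTIRE** [folklore]: coefficients with `‖aₙ‖ ≤ C_R∕Rⁿ` for every `R > 0` have infinite radius of convergence, so
`z ↦ Σₙ zⁿ·aₙ` is analytic at every point of ℂ (Mathlib `FormalMultilinearSeries.ofScalars`, `le_radius_of_bound`, `hasFPowerSeriesOnBall`). -/
theorem analyticAt_tsum_of_coeff_bound {a : ℕ → ℂ} {C : ℝ → ℝ} (ha : ∀ R : ℝ, 0 < R → ∀ n, ‖a n‖ ≤ C R / R ^ n) (z : ℂ) :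
    AnalyticAt ℂ (fun w : ℂ => ∑' n, w ^ n • a n) z := by
  set p : FormalMultilinearSeries ℂ ℂ ℂ := FormalMultilinearSeries.ofScalars ℂ a with hp
  -- infinite radius of convergence
  have hrad : p.radius = ⊤ := by
    refine ENNReal.eq_top_of_forall_nnreal_le fun R => ?_
    rcases eq_or_ne R 0 with hR0 | hR0
    · simp [hR0]
    have hRpos : 0 < (R : ℝ) := by exact_mod_cast pos_iff_ne_zero.2 hR0
    refine p.le_radius_of_bound (C R) fun n => ?_
    rw [hp, FormalMultilinearSeries.ofScalars_norm]
    have hRn : 0 < (R : ℝ) ^ n := pow_pos hRpos n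
    calc ‖a n‖ * (R : ℝ) ^ n ≤ C R / (R : ℝ) ^ n * (R : ℝ) ^ n := mul_le_mul_of_nonneg_right (ha R hRpos n) hRn.le
      _ = C R := div_mul_cancel₀ _ hRn.ne'
  have hps : HasFPowerSeriesOnBall p.sum p 0 ⊤ := by
    have h := p.hasFPowerSeriesOnBall (by simp [hrad])
    rwa [hrad] at h
  have hfun : (fun w : ℂ => ∑' n, w ^ n • a n) = p.sum := by
    funext w
    have e : FormalMultilinearSeries.ofScalarsSum (E := ℂ) a w = ∑' n, a n • w ^ n :=
      FormalMultilinearSeries.ofScalars_sum_eq (E := ℂ) a w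
    rw [show p.sum w = FormalMultilinearSeries.ofScalarsSum (E := ℂ) a w from rfl, e]
    exact tsum_congr fun n => by rw [smul_eq_mul, smul_eq_mul, mul_comm]
  rw [hfun]
  exact hps.analyticAt_of_mem (by simp)

/-- **THE LIMIT OF THE COMPLEX MGF's IS AN ENTIRE FUNCTION, POSITIVE ON ℝ, WHOSE LOGARITHM ON ℝ IS THE LIMIT OF THE CGF's** [folklore].
Probability measures `μ K`, `|X K| ≤ B` measurable a.e.; cgf's convergent on `(0, r)`.  Then there is `Φ : ℂ → ℂ`, analytic at every point, with
`complexMGF (X K) (μ K) z → Φ z` (every `z ∈ ℂ`), `e^{−|t|B} ≤ Re Φ(t)` and `mgf (X K) (μ K) t → Re Φ(t)`, `cgf (X K) (μ K) t → log Re Φ(t)` (every `t ∈ ℝ`). -/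
theorem exists_entire_limit_complexMGF (hX : ∀ K, AEMeasurable (X K) (μ K)) (hB : ∀ K ω, |X K ω| ≤ B) (hr : 0 < r)
    (hconv : ∀ t : ℝ, 0 < t → t < r → ∃ y, Tendsto (fun K => cgf (X K) (μ K) t) atTop (𝓝 y)) :
    ∃ Φ : ℂ → ℂ, (∀ z, AnalyticAt ℂ Φ z) ∧ (∀ z, Tendsto (fun K => complexMGF (X K) (μ K) z) atTop (𝓝 (Φ z))) ∧
      (∀ t : ℝ, Real.exp (-(|t| * B)) ≤ (Φ t).re) ∧ (∀ t : ℝ, Tendsto (fun K => mgf (X K) (μ K) t) atTop (𝓝 (Φ t).re)) ∧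
      ∀ t : ℝ, Tendsto (fun K => cgf (X K) (μ K) t) atTop (𝓝 (Real.log (Φ t).re)) := by
  obtain ⟨a, -, hbd, hlim⟩ := exists_taylorLimit_complexMGF hX hB hr hconv
  refine ⟨fun z => ∑' n, z ^ n • a n, fun z => analyticAt_tsum_of_coeff_bound hbd z, hlim, ?_⟩
  -- on the real axis: real parts, positivity, logarithm
  have hre : ∀ t : ℝ, Tendsto (fun K => mgf (X K) (μ K) t) atTop (𝓝 (∑' n, (t : ℂ) ^ n • a n).re) := fun t => by
    refine ((Complex.continuous_re.tendsto _).comp (hlim t)).congr fun K => ?_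
    simp only [Function.comp_apply, complexMGF_ofReal, Complex.ofReal_re]
  have hpos : ∀ t : ℝ, Real.exp (-(|t| * B)) ≤ (∑' n, (t : ℂ) ^ n • a n).re := fun t => by
    refine ge_of_tendsto' (hre t) fun K => ?_
    have h := T4GenFunBounds.exp_neg_le_mgf_of_abs_le (hX K) (ae_of_all _ (hB K)) t
    rwa [probReal_univ, one_mul] at h
  refine ⟨hpos, hre, fun t => ?_⟩
  have hne : (∑' n, (t : ℂ) ^ n • a n).re ≠ 0 := ((Real.exp_pos _).trans_le (hpos t)).ne'
  refine (((Real.continuousAt_log hne).tendsto).comp (hre t)).congr fun K => ?_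
  simp only [Function.comp_apply, cgf]

/-- **THE LIMIT OF THE CGF's IS A REAL-ANALYTIC FUNCTION ON ALL OF ℝ** [folklore]: under the hypotheses of `exists_entire_limit_complexMGF` there is a
real-analytic `g : ℝ → ℝ` (namely `log Re Φ|_ℝ`; Mathlib `analyticAt_log`, `AnalyticAt.re_ofReal`) with `cgf (X K) (μ K) t → g t` for EVERY `t ∈ ℝ`. -/
theorem exists_analytic_limit_cgf (hX : ∀ K, AEMeasurable (X K) (μ K)) (hB : ∀ K ω, |X K ω| ≤ B) (hr : 0 < r)
    (hconv : ∀ t : ℝ, 0 < t → t < r → ∃ y, Tendsto (fun K => cgf (X K) (μ K) t) atTop (𝓝 y)) :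
    ∃ g : ℝ → ℝ, (∀ t, AnalyticAt ℝ g t) ∧ ∀ t, Tendsto (fun K => cgf (X K) (μ K) t) atTop (𝓝 (g t)) := by
  obtain ⟨Φ, hΦ, -, hpos, -, hcgf⟩ := exists_entire_limit_complexMGF hX hB hr hconv
  refine ⟨fun t => Real.log (Φ t).re, fun t => ?_, hcgf⟩
  have h1 : AnalyticAt ℝ (fun x : ℝ => (Φ x).re) t := (hΦ (t : ℂ)).re_ofReal
  have h2 : AnalyticAt ℝ Real.log ((fun x : ℝ => (Φ x).re) t) := analyticAt_log ((Real.exp_pos _).trans_le (hpos t))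
  have h3 : AnalyticAt ℝ (Real.log ∘ fun x : ℝ => (Φ x).re) t := AnalyticAt.comp (f := fun x : ℝ => (Φ x).re) (x := t) h2 h1
  exact h3

end Generic

/-! ## §2 At the torus scheme under N19's DECL target (any window): the continuum generating function is REAL-ANALYTIC on all of ℝ [bookkeeping] -/

section Scheme

open T4CauchySum (genFun genFunLim)
open T4GenFunBounds (schemeZ prodObs)
open Missing (TorusScheme)
open Summit.QuantumFields.BalabanUV.T4Continuum.Spine
open Summit.QuantumFields.YangMills.BalabanUVNodes.N19TargetEverySource (tendsto_cgf_gibbs_of_target)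

variable {G : Type*} [GaugeGroup G] [MeasurableSpace G] [RegularGaugeGroup G] [HaarData G] {O : Type*}
  (S : TorusScheme G O) (hβ : ∀ K, 0 ≤ S.β K) (hm : ∀ K o, Measurable (S.obs K o))
  (h1 : ∀ K o U, |S.obs K o U| ≤ 1)
include hβ hm h1

/-- ★ **THE COMPLEX GENERATING FUNCTIONS CONVERGE TO AN ENTIRE FUNCTION**: under `Spine.NE7.Target vol l₀ δ (schemeZ S os)` (`0 < l₀`) there is
`Φ : ℂ → ℂ`, analytic at every point, with `⟨e^{z·∏os}⟩_K → Φ(z)` for every `z ∈ ℂ`, `Re Φ(t) ≥ e^{−|t|}` on ℝ, and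
`genFun (schemeZ S os) K t → log Re Φ(t)` for EVERY real `t`.  `Target` is a HYPOTHESIS. [folklore] -/
theorem exists_entire_limit_of_target {vol l₀ : ℝ} {δ : ℕ → ℝ} (hl₀ : 0 < l₀) (os : List O) (hT : NE7.Target vol l₀ δ (schemeZ S os)) :
    ∃ Φ : ℂ → ℂ, (∀ z, AnalyticAt ℂ Φ z) ∧
      (∀ z, Tendsto (fun K => complexMGF (prodObs S K os) (T4GenFunBounds.gibbsMeasure (S.P K) (S.β K)) z) atTop (𝓝 (Φ z))) ∧
      (∀ t : ℝ, Real.exp (-(|t| * 1)) ≤ (Φ t).re) ∧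
      ∀ t : ℝ, Tendsto (fun K => genFun (schemeZ S os) K t) atTop (𝓝 (Real.log (Φ t).re)) := by
  haveI hP : ∀ K, IsProbabilityMeasure (T4GenFunBounds.gibbsMeasure (G := G) (S.P K) (S.β K)) := fun K =>
    T4GenFunBounds.isProbabilityMeasure_gibbsMeasure (G := G) (S.P K) (hβ K)
  obtain ⟨Φ, hΦ, hlim, hpos, -, hcgf⟩ := exists_entire_limit_complexMGF (μ := fun K => T4GenFunBounds.gibbsMeasure (S.P K) (S.β K))
    (X := fun K => prodObs S K os) (fun K => (T4GenFunBounds.measurable_prodObs S hm K os).aemeasurable)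
    (fun K => T4GenFunBounds.abs_prodObs_le_one S h1 K os) hl₀ (tendsto_cgf_gibbs_of_target S hβ hm h1 hl₀ os hT)
  refine ⟨Φ, hΦ, hlim, hpos, fun t => (hcgf t).congr fun K => ?_⟩
  exact (T4GenFunBounds.genFun_schemeZ_eq_cgf S hβ hm h1 K os t).symm

/-- ★★ **THE CONTINUUM GENERATING FUNCTION IS REAL-ANALYTIC ON ALL OF ℝ.**  Under `Spine.NE7.Target vol l₀ δ (schemeZ S os)` (`0 < l₀`; ANY window):
`T4CauchySum.genFunLim (schemeZ S os)` is analytic at every `t ∈ ℝ` — it is the logarithm of the (positive) restriction to ℝ of the entire limit of the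
complex generating functions, and `genFun (schemeZ S os) K t → genFunLim (schemeZ S os) t` for EVERY real `t`.  `Target` is a HYPOTHESIS. [folklore] -/
theorem analyticAt_genFunLim_of_target {vol l₀ : ℝ} {δ : ℕ → ℝ} (hl₀ : 0 < l₀) (os : List O) (hT : NE7.Target vol l₀ δ (schemeZ S os))
    (t : ℝ) : AnalyticAt ℝ (genFunLim (schemeZ S os)) t ∧ Tendsto (fun K => genFun (schemeZ S os) K t) atTop (𝓝 (genFunLim (schemeZ S os) t)) := by
  obtain ⟨Φ, hΦ, -, hpos, hcgf⟩ := exists_entire_limit_of_target S hβ hm h1 hl₀ os hT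
  have hfun : genFunLim (schemeZ S os) = fun s : ℝ => Real.log (Φ s).re := funext fun s => (hcgf s).limUnder_eq
  rw [hfun]
  have h1 : AnalyticAt ℝ (fun x : ℝ => (Φ x).re) t := (hΦ (t : ℂ)).re_ofReal
  have h2 : AnalyticAt ℝ Real.log ((fun x : ℝ => (Φ x).re) t) := analyticAt_log ((Real.exp_pos _).trans_le (hpos t))
  have h3 : AnalyticAt ℝ (Real.log ∘ fun x : ℝ => (Φ x).re) t := AnalyticAt.comp (f := fun x : ℝ => (Φ x).re) (x := t) h2 h1
  exact ⟨h3, hcgf t⟩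

/-- Hence the continuum generating function is SMOOTH (`ContDiffAt ℝ n` for every `n`) at every real source. [folklore] -/
theorem contDiffAt_genFunLim_of_target {vol l₀ : ℝ} {δ : ℕ → ℝ} (hl₀ : 0 < l₀) (os : List O) (hT : NE7.Target vol l₀ δ (schemeZ S os))
    (t : ℝ) {n : WithTop ℕ∞} : ContDiffAt ℝ n (genFunLim (schemeZ S os)) t :=
  (analyticAt_genFunLim_of_target S hβ hm h1 hl₀ os hT t).1.contDiffAt

end Scheme

end Summit.QuantumFields.YangMills.BalabanUVNodes.N19ContinuumGenFunAnalytic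

end
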